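import Summits.CriticalPhenomena.PercolationContinuityZ3.Theorems.Transplant.FKConnectivityAllQPat3MinorCone
import Summits.CriticalPhenomena.PercolationContinuityZ3.Theorems.Transplant.FKConnectivityAllQPat3MinorInduction
import Summits.CriticalPhenomena.PercolationContinuityZ3.Theorems.Transplant.FKConnectivityAllQPat3GenDict
import Summits.CriticalPhenomena.PercolationContinuityZ3.Theorems.Transplant.FKConnectivityAllQAntipodalMinorGluing
import HarnessLib

/-!
# Connectivity correlation inequalities for `φ_{w,q}`, every `q > 0` — THETA and RING gluing laws and certificates on MINORS

Proof file (`--supports stmt-CriticalPhenomena-4575`), census lineage (gen 37) of LANE 2's FK sub-programme; builds on p205010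
(kernel theorem, internal audit signed; external expert review pending).  No definitions, no named facts, no sorries.

Census g36's Stage-S2 pipeline with the contracted sets riding along.  Pieces are MINORS `(E_p, C_p)` (free / contracted,
`E_p, C_p ⊆ N_p`) of three two-terminal series–parallel networks `N_K, N₁, N₂` in the THETA resp. RING configuration; the composite
minor is `(E_K ∪ E₁ ∪ E₂, C_K ∪ C₁ ∪ C₂)`.  `FK.apExpC_union3_theta/ring` (fk-2's `FK.apExpC_parallel/series` twice),
`FK.tvalC_union3_theta/ring` (the trilinear decompositions; the pattern laws `FK.pat3_union3_theta/ring` apply verbatim to the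
configurations `γ_p ∪ C_p`), the dictionary validity on minors `FK.Gen.lev2C_nonneg` for the generators the certificates use
(`FK.Gen.okC`: family members — census g37's `FK.famT12C_nonneg` —, entries and orbit indicators), and the data-facing wrappers
**`FK.thetaC_level_nonneg_of_symCertG`** / **`FK.ringC_level_nonneg_of_symCertG`**: the SAME symmetrised certificates as for
`C = ∅` give `0 ≤ D · lev2C (E_K ∪ E₁ ∪ E₂) (C_K ∪ C₁ ∪ C₂) b s t T λ` at every level.
[cite: AyyerLinussonRavichandran2025, §7 eq. (13)–(15) (p. 22)] [cite: Grimmett2006, §3.8 (pp. 61–62)]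
-/

noncomputable section

namespace Summit.CriticalPhenomena.PercolationContinuityZ3.Theorems

namespace FK

open SimpleGraph Literature.Probability.LatticeModels Literature.Probability.Percolation
open scoped Classical

variable {V : Type*} [Fintype V]

/-! ### Dictionary validity on minors (family members, entries, orbit indicators) -/

section GenMinor

/-- Executable side condition of a generator usable on MINORS: a claimed family member agrees with one of the fourteen `famT12`
members on levels `0, 1`; entries and orbit indicators are unconditional; (U-rectangles are not admitted here — the THEOREM SP
certificates of census g36 use none). [folklore] -/
def Gen.okC : Gen → Bool
  | Gen.fam t => (List.range 14).any fun i => agrees01 t (famGet famT12 i)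
  | Gen.urect _ _ => false
  | Gen.usym _ _ => false
  | Gen.entry _ _ _ => true
  | Gen.orb _ _ => true

omit [Fintype V] in
/-- `FK.lev2C` reads only levels `0` and `1` of the table. [folklore] -/
theorem lev2C_congr01 {F G : ℕ → Pat3 → Pat3 → ℤ} (h0 : ∀ P Q, F 0 P Q = G 0 P Q) (h1 : ∀ P Q, F 1 P Q = G 1 P Q)
    (E C : Finset (Sym2 V)) (x y s : V) (μ : ℕ) : lev2C E C x y s F μ = lev2C E C x y s G μ := by
  unfold lev2C
  simp only [h0, h1]

omit [Fintype V] in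
/-- A table with nonnegative coefficients is levelwise nonnegative on every minor. [folklore] -/
theorem lev2C_nonneg_of_coef' {E C : Finset (Sym2 V)} {x y s : V} {F : ℕ → Pat3 → Pat3 → ℤ} (hF : ∀ c P Q, 0 ≤ F c P Q)
    (μ : ℕ) : 0 ≤ lev2C E C x y s F μ := by
  unfold lev2C
  refine Finset.sum_nonneg fun γ _ => add_nonneg ?_ ?_ <;> split_ifs <;> first | exact hF _ _ _ | exact le_rfl

/-- **Validity of the dictionary on minors**: on a minor `(E, C)` (`E, C ⊆ N`) of a two-terminal series–parallel piece `N` between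
`x, y` with inner mark `s`, every generator passing `FK.Gen.okC` is levelwise nonnegative (`FK.famT12C_nonneg`; coefficientwise for
entries / orbit indicators). [cite: AyyerLinussonRavichandran2025, §7 (p. 22)] -/
theorem Gen.lev2C_nonneg {N E C : Finset (Sym2 V)} {x y s : V} (hN : IsTTSP N x y) (hE : E ⊆ N) (hC : C ⊆ N)
    (hs : ∃ e ∈ N, s ∈ e) (hsx : s ≠ x) (hsy : s ≠ y) : ∀ g : Gen, g.okC = true → ∀ μ : ℕ, 0 ≤ lev2C E C x y s g.tab μ
  | Gen.fam t, h, μ => by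
      unfold Gen.okC at h
      rw [List.any_eq_true] at h
      obtain ⟨i, _, hi⟩ := h
      have ha := agrees01_spec hi
      rw [Gen.tab, lev2C_congr01 ha.1 ha.2]
      exact lev2C_nonneg_of_mval2C (fun w hw => famT12C_nonneg hN hE hC hs hsx hsy hw i) μ
  | Gen.urect U D, h, μ => by simp [Gen.okC] at h
  | Gen.usym U D, h, μ => by simp [Gen.okC] at h
  | Gen.entry c₀ P₀ Q₀, _, μ =>
      lev2C_nonneg_of_coef' (fun c P Q => by simp only [Gen.tab]; split_ifs <;> norm_num) μ
  | Gen.orb P₀ Q₀, _, μ =>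
      lev2C_nonneg_of_coef' (fun c P Q => by simp only [Gen.tab, orbTab]; split_ifs <;> norm_num) μ

/-- All three generators of a product pass `FK.Gen.okC`. [folklore] -/
def Prod3G.okC (p : Prod3G) : Bool := p.gK.okC && p.g1.okC && p.g2.okC

/-- **Validity of a dictionary product list on the minors of three series–parallel pieces.** [folklore] -/
theorem Prod3G.valid3C {NK N₁ N₂ EK CK E₁ C₁ E₂ C₂ : Finset (Sym2 V)} {xK yK sK x₁ y₁ s₁ x₂ y₂ s₂ : V}
    (hKsp : IsTTSP NK xK yK) (h1sp : IsTTSP N₁ x₁ y₁) (h2sp : IsTTSP N₂ x₂ y₂)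
    (hEK : EK ⊆ NK) (hCK : CK ⊆ NK) (hE₁ : E₁ ⊆ N₁) (hC₁ : C₁ ⊆ N₁) (hE₂ : E₂ ⊆ N₂) (hC₂ : C₂ ⊆ N₂)
    (hbK : ∃ e ∈ NK, sK ∈ e) (hs1 : ∃ e ∈ N₁, s₁ ∈ e) (ht2 : ∃ e ∈ N₂, s₂ ∈ e)
    (hKx : sK ≠ xK) (hKy : sK ≠ yK) (h1x : s₁ ≠ x₁) (h1y : s₁ ≠ y₁) (h2x : s₂ ≠ x₂) (h2y : s₂ ≠ y₂)
    (prods : List Prod3G) (hok : (prods.all Prod3G.okC) = true) :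
    ∀ j ∈ (Finset.univ : Finset (Fin (prods.map Prod3G.toProd3).length)), ∀ μ : ℕ,
      0 ≤ lev2C EK CK xK yK sK ((prods.map Prod3G.toProd3).get j).gK μ ∧
        0 ≤ lev2C E₁ C₁ x₁ y₁ s₁ ((prods.map Prod3G.toProd3).get j).g1 μ ∧
        0 ≤ lev2C E₂ C₂ x₂ y₂ s₂ ((prods.map Prod3G.toProd3).get j).g2 μ := by
  intro j _ μ
  have hp : (prods.map Prod3G.toProd3).get j ∈ prods.map Prod3G.toProd3 := List.get_mem _ j
  rw [List.mem_map] at hp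
  obtain ⟨g, hg, hgj⟩ := hp
  rw [← hgj]
  rw [List.all_eq_true] at hok
  have h := hok g hg
  simp only [Prod3G.okC, Bool.and_eq_true] at h
  exact ⟨Gen.lev2C_nonneg hKsp hEK hCK hbK hKx hKy _ h.1.1 μ, Gen.lev2C_nonneg h1sp hE₁ hC₁ hs1 h1x h1y _ h.1.2 μ,
    Gen.lev2C_nonneg h2sp hE₂ hC₂ ht2 h2x h2y _ h.2 μ⟩

end GenMinor

/-! ### THETA on minors -/

section ThetaMinor

variable {NK N₁ N₂ EK CK E₁ C₁ E₂ C₂ : Finset (Sym2 V)} {VK V₁ V₂ : Set V} {u v : V}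

/-- **Contracted exponent across a THETA gluing of minors** (fk-2's `FK.apExpC_parallel` twice). [folklore] -/
theorem apExpC_union3_theta (hdK1 : Disjoint NK N₁) (hdK2 : Disjoint NK N₂) (hd12 : Disjoint N₁ N₂)
    (hK : ∀ e ∈ (↑NK : Set (Sym2 V)), ∀ z ∈ e, z ∈ VK)
    (h₁ : ∀ e ∈ (↑N₁ : Set (Sym2 V)), ∀ z ∈ e, z ∈ V₁) (h₂ : ∀ e ∈ (↑N₂ : Set (Sym2 V)), ∀ z ∈ e, z ∈ V₂)
    (hK1 : VK ∩ V₁ ⊆ ({u, v} : Set V)) (hK2 : VK ∩ V₂ ⊆ ({u, v} : Set V)) (h12 : V₁ ∩ V₂ ⊆ ({u, v} : Set V)) (huv : u ≠ v)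
    (hEK : EK ⊆ NK) (hCK : CK ⊆ NK) (hE₁ : E₁ ⊆ N₁) (hC₁ : C₁ ⊆ N₁) (hE₂ : E₂ ⊆ N₂) (hC₂ : C₂ ⊆ N₂)
    (b s t : V) {γK γ₁ γ₂ : Finset (Sym2 V)} (gK : γK ⊆ EK) (g₁ : γ₁ ⊆ E₁) (g₂ : γ₂ ⊆ E₂) :
    apExpC (EK ∪ E₁ ∪ E₂) (CK ∪ C₁ ∪ C₂) (γK ∪ γ₁ ∪ γ₂) + 4 * Fintype.card V =
      apExpC EK CK γK + apExpC E₁ C₁ γ₁ + apExpC E₂ C₂ γ₂ +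
          corr3 (pat3 (γK ∪ CK) u v b) (pat3 (γ₁ ∪ C₁) u v s) (pat3 (γ₂ ∪ C₂) u v t) +
        corr3 (pat3 (EK \ γK ∪ CK) u v b) (pat3 (E₁ \ γ₁ ∪ C₁) u v s) (pat3 (E₂ \ γ₂ ∪ C₂) u v t) := by
  have hd : Disjoint (NK ∪ N₁) N₂ := Finset.disjoint_union_left.2 ⟨hdK2, hd12⟩
  have hdE : Disjoint EK E₁ := Finset.disjoint_of_subset_left hEK (Finset.disjoint_of_subset_right hE₁ hdK1)
  have e1 := apExpC_parallel hdK1 hK h₁ hK1 huv hEK hE₁ hCK hC₁ gK g₁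
  have e2 := apExpC_parallel hd (edges_union_verts hK h₁) h₂ (union_inter_subset_pair' hK2 h12) huv
    (Finset.union_subset_union hEK hE₁) hE₂ (Finset.union_subset_union hCK hC₁) hC₂ (Finset.union_subset_union gK g₁) g₂
  have sγK : γK ∪ CK ⊆ NK := Finset.union_subset (gK.trans hEK) hCK
  have sγ₁ : γ₁ ∪ C₁ ⊆ N₁ := Finset.union_subset (g₁.trans hE₁) hC₁
  have sγK' : EK \ γK ∪ CK ⊆ NK := Finset.union_subset (Finset.sdiff_subset.trans hEK) hCK
  have sγ₁' : E₁ \ γ₁ ∪ C₁ ⊆ N₁ := Finset.union_subset (Finset.sdiff_subset.trans hE₁) hC₁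
  rw [ite_prop_eq_ite_bool
      (p := (openGraph (↑(γK ∪ CK) : BondConfig V)).Reachable u v ∧ (openGraph (↑(γ₁ ∪ C₁) : BondConfig V)).Reachable u v)
      (bb := (pat3 (γK ∪ CK) u v b).xy && (pat3 (γ₁ ∪ C₁) u v s).xy) (by rw [Bool.and_eq_true, pat3_xy_iff, pat3_xy_iff]),
    ite_prop_eq_ite_bool
      (p := (openGraph (↑(EK \ γK ∪ CK) : BondConfig V)).Reachable u v ∧
        (openGraph (↑(E₁ \ γ₁ ∪ C₁) : BondConfig V)).Reachable u v)
      (bb := (pat3 (EK \ γK ∪ CK) u v b).xy && (pat3 (E₁ \ γ₁ ∪ C₁) u v s).xy)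
      (by rw [Bool.and_eq_true, pat3_xy_iff, pat3_xy_iff])] at e1
  rw [Finset.union_union_union_comm γK γ₁ CK C₁, sdiff_union_union_distrib hdE gK g₁ CK C₁,
    ite_prop_eq_ite_bool
      (p := (openGraph (↑(γK ∪ CK ∪ (γ₁ ∪ C₁)) : BondConfig V)).Reachable u v ∧
        (openGraph (↑(γ₂ ∪ C₂) : BondConfig V)).Reachable u v)
      (bb := ((pat3 (γK ∪ CK) u v b).xy || (pat3 (γ₁ ∪ C₁) u v s).xy) && (pat3 (γ₂ ∪ C₂) u v t).xy)
      (by rw [Bool.and_eq_true, Bool.or_eq_true, pat3_xy_iff, pat3_xy_iff, pat3_xy_iff,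
        reachable_union_parallel hK h₁ hK1 sγK sγ₁]),
    ite_prop_eq_ite_bool
      (p := (openGraph (↑(EK \ γK ∪ CK ∪ (E₁ \ γ₁ ∪ C₁)) : BondConfig V)).Reachable u v ∧
        (openGraph (↑(E₂ \ γ₂ ∪ C₂) : BondConfig V)).Reachable u v)
      (bb := ((pat3 (EK \ γK ∪ CK) u v b).xy || (pat3 (E₁ \ γ₁ ∪ C₁) u v s).xy) && (pat3 (E₂ \ γ₂ ∪ C₂) u v t).xy)
      (by rw [Bool.and_eq_true, Bool.or_eq_true, pat3_xy_iff, pat3_xy_iff, pat3_xy_iff,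
        reachable_union_parallel hK h₁ hK1 sγK' sγ₁'])] at e2
  unfold corr3
  omega

/-- **Trilinear decomposition of `tvalC` over a THETA gluing of minors.** [folklore] -/
theorem tvalC_union3_theta (hdK1 : Disjoint NK N₁) (hdK2 : Disjoint NK N₂) (hd12 : Disjoint N₁ N₂)
    (hK : ∀ e ∈ (↑NK : Set (Sym2 V)), ∀ z ∈ e, z ∈ VK)
    (h₁ : ∀ e ∈ (↑N₁ : Set (Sym2 V)), ∀ z ∈ e, z ∈ V₁) (h₂ : ∀ e ∈ (↑N₂ : Set (Sym2 V)), ∀ z ∈ e, z ∈ V₂)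
    (hK1 : VK ∩ V₁ ⊆ ({u, v} : Set V)) (hK2 : VK ∩ V₂ ⊆ ({u, v} : Set V)) (h12 : V₁ ∩ V₂ ⊆ ({u, v} : Set V)) (huv : u ≠ v)
    (hEK : EK ⊆ NK) (hCK : CK ⊆ NK) (hE₁ : E₁ ⊆ N₁) (hC₁ : C₁ ⊆ N₁) (hE₂ : E₂ ⊆ N₂) (hC₂ : C₂ ⊆ N₂)
    {b s t : V} (hb1 : b ∉ V₁) (hb2 : b ∉ V₂) (hsK : s ∉ VK) (hs2 : s ∉ V₂) (htK : t ∉ VK) (ht1 : t ∉ V₁)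
    (hbu : b ≠ u) (hbv : b ≠ v) (hsu : s ≠ u) (hsv : s ≠ v) (htu : t ≠ u) (htv : t ≠ v)
    (hbs : b ≠ s) (hbt : b ≠ t) (hst : s ≠ t) (w : ℕ → ℝ) (tab : Pat3 → Pat3 → ℤ) :
    tvalC (fun n => w (n + 4 * Fintype.card V)) (EK ∪ E₁ ∪ E₂) (CK ∪ C₁ ∪ C₂) b s t tab =
      ∑ γK ∈ EK.powerset, ∑ γ₁ ∈ E₁.powerset, ∑ γ₂ ∈ E₂.powerset,
        w (apExpC EK CK γK + apExpC E₁ C₁ γ₁ + apExpC E₂ C₂ γ₂ +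
              corr3 (pat3 (γK ∪ CK) u v b) (pat3 (γ₁ ∪ C₁) u v s) (pat3 (γ₂ ∪ C₂) u v t) +
            corr3 (pat3 (EK \ γK ∪ CK) u v b) (pat3 (E₁ \ γ₁ ∪ C₁) u v s) (pat3 (E₂ \ γ₂ ∪ C₂) u v t)) *
          (tab (join3 (pat3 (γK ∪ CK) u v b) (pat3 (γ₁ ∪ C₁) u v s) (pat3 (γ₂ ∪ C₂) u v t))
            (join3 (pat3 (EK \ γK ∪ CK) u v b) (pat3 (E₁ \ γ₁ ∪ C₁) u v s) (pat3 (E₂ \ γ₂ ∪ C₂) u v t)) : ℝ) := by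
  have hdE1 : Disjoint EK E₁ := Finset.disjoint_of_subset_left hEK (Finset.disjoint_of_subset_right hE₁ hdK1)
  have hdE2 : Disjoint EK E₂ := Finset.disjoint_of_subset_left hEK (Finset.disjoint_of_subset_right hE₂ hdK2)
  have hdE12 : Disjoint E₁ E₂ := Finset.disjoint_of_subset_left hE₁ (Finset.disjoint_of_subset_right hE₂ hd12)
  have hd : Disjoint (EK ∪ E₁) E₂ := Finset.disjoint_union_left.2 ⟨hdE2, hdE12⟩
  unfold tvalC
  beta_reduce
  rw [sum_powerset_union_disj hd]
  rw [sum_powerset_union_disj hdE1]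
  refine Finset.sum_congr rfl fun γK hγK => Finset.sum_congr rfl fun γ₁ hγ₁ => Finset.sum_congr rfl fun γ₂ hγ₂ => ?_
  have gK := Finset.mem_powerset.1 hγK
  have g₁ := Finset.mem_powerset.1 hγ₁
  have g₂ := Finset.mem_powerset.1 hγ₂
  have p1 := pat3_union3_theta hK h₁ h₂ hK1 hK2 h12 hb1 hb2 hsK hs2 htK ht1 hbu hbv hsu hsv htu htv hbs hbt hst
    (Finset.union_subset (gK.trans hEK) hCK) (Finset.union_subset (g₁.trans hE₁) hC₁) (Finset.union_subset (g₂.trans hE₂) hC₂)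
  have sK' : EK \ γK ∪ CK ⊆ NK := Finset.union_subset (Finset.sdiff_subset.trans hEK) hCK
  have s1' : E₁ \ γ₁ ∪ C₁ ⊆ N₁ := Finset.union_subset (Finset.sdiff_subset.trans hE₁) hC₁
  have s2' : E₂ \ γ₂ ∪ C₂ ⊆ N₂ := Finset.union_subset (Finset.sdiff_subset.trans hE₂) hC₂
  have p2 := pat3_union3_theta hK h₁ h₂ hK1 hK2 h12 hb1 hb2 hsK hs2 htK ht1 hbu hbv hsu hsv htu htv hbs hbt hst sK' s1' s2'
  have eγ : γK ∪ γ₁ ∪ γ₂ ∪ (CK ∪ C₁ ∪ C₂) = γK ∪ CK ∪ (γ₁ ∪ C₁) ∪ (γ₂ ∪ C₂) := by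
    ext e
    simp only [Finset.mem_union]
    tauto
  have eγ' : (EK ∪ E₁ ∪ E₂) \ (γK ∪ γ₁ ∪ γ₂) ∪ (CK ∪ C₁ ∪ C₂) = EK \ γK ∪ CK ∪ (E₁ \ γ₁ ∪ C₁) ∪ (E₂ \ γ₂ ∪ C₂) := by
    rw [sdiff_union_union_distrib hd (Finset.union_subset_union gK g₁) g₂, sdiff_union_union_distrib hdE1 gK g₁]
  rw [eγ, eγ', apExpC_union3_theta hdK1 hdK2 hd12 hK h₁ h₂ hK1 hK2 h12 huv hEK hCK hE₁ hC₁ hE₂ hC₂ b s t gK g₁ g₂, p1, p2]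

/-- **THETA on minors from data (symmetrised certificate):** three two-terminal series–parallel `(u, v)`-pieces `N_K, N₁, N₂`
(spans pairwise meeting inside `{u, v}`, inner marks `b, s, t`), minors `(E_p, C_p)` of the pieces, a product list over the
dictionary passing `Prod3G.okC`, and the symmetrised certificate family ⇒
`0 ≤ D · lev2C (E_K ∪ E₁ ∪ E₂) (C_K ∪ C₁ ∪ C₂) b s t T λ` at every level. [cite: AyyerLinussonRavichandran2025, §7 (p. 22)] -/
theorem thetaC_level_nonneg_of_symCertG (hdK1 : Disjoint NK N₁) (hdK2 : Disjoint NK N₂) (hd12 : Disjoint N₁ N₂)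
    (hK : ∀ e ∈ (↑NK : Set (Sym2 V)), ∀ z ∈ e, z ∈ VK)
    (h₁ : ∀ e ∈ (↑N₁ : Set (Sym2 V)), ∀ z ∈ e, z ∈ V₁) (h₂ : ∀ e ∈ (↑N₂ : Set (Sym2 V)), ∀ z ∈ e, z ∈ V₂)
    (hK1 : VK ∩ V₁ ⊆ ({u, v} : Set V)) (hK2 : VK ∩ V₂ ⊆ ({u, v} : Set V)) (h12 : V₁ ∩ V₂ ⊆ ({u, v} : Set V)) (huv : u ≠ v)
    (hEK : EK ⊆ NK) (hCK : CK ⊆ NK) (hE₁ : E₁ ⊆ N₁) (hC₁ : C₁ ⊆ N₁) (hE₂ : E₂ ⊆ N₂) (hC₂ : C₂ ⊆ N₂)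
    {b s t : V} (hb1 : b ∉ V₁) (hb2 : b ∉ V₂) (hsK : s ∉ VK) (hs2 : s ∉ V₂) (htK : t ∉ VK) (ht1 : t ∉ V₁)
    (hbu : b ≠ u) (hbv : b ≠ v) (hsu : s ≠ u) (hsv : s ≠ v) (htu : t ≠ u) (htv : t ≠ v)
    (hbs : b ≠ s) (hbt : b ≠ t) (hst : s ≠ t)
    (hKsp : IsTTSP NK u v) (h1sp : IsTTSP N₁ u v) (h2sp : IsTTSP N₂ u v)
    (hbK : ∃ e ∈ NK, b ∈ e) (hs1 : ∃ e ∈ N₁, s ∈ e) (ht2 : ∃ e ∈ N₂, t ∈ e)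
    (T : ℕ → Pat3 → Pat3 → ℤ) (D : ℕ) (prods : List Prod3G) (hok : (prods.all Prod3G.okC) = true)
    (hcert : ∀ d : ℕ, ∀ PK QK P1 Q1 P2 Q2 : Pat3,
      8 * ∑ j : Fin (prods.map Prod3G.toProd3).length,
          (((prods.map Prod3G.toProd3).get j).lam : ℤ) * ((prods.map Prod3G.toProd3).get j).tensor d PK QK P1 Q1 P2 Q2 ≤
        D * target3Sym join3 corr3 T d PK QK P1 Q1 P2 Q2)
    (lam : ℕ) : 0 ≤ (D : ℤ) * lev2C (EK ∪ E₁ ∪ E₂) (CK ∪ C₁ ∪ C₂) b s t T lam :=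
  cone3C_level_nonneg_sym join3 corr3 (4 * Fintype.card V)
    (fun wt tab => tvalC_union3_theta hdK1 hdK2 hd12 hK h₁ h₂ hK1 hK2 h12 huv hEK hCK hE₁ hC₁ hE₂ hC₂ hb1 hb2 hsK hs2 htK ht1
      hbu hbv hsu hsv htu htv hbs hbt hst wt tab)
    T D Finset.univ (fun j => (prods.map Prod3G.toProd3).get j) hcert
    (Prod3G.valid3C hKsp h1sp h2sp hEK hCK hE₁ hC₁ hE₂ hC₂ hbK hs1 ht2 hbu hbv hsu hsv htu htv prods hok) lam

end ThetaMinor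

/-! ### RING on minors -/

section RingMinor

variable {NK N₁ N₂ EK CK E₁ C₁ E₂ C₂ : Finset (Sym2 V)} {VK V₁ V₂ : Set V} {u v w : V}

/-- **Contracted exponent across a RING gluing of minors** (fk-2's `FK.apExpC_series` inside `Q₁ ∪ Q₂` and `FK.apExpC_parallel`
for `K` across `{u, v}`). [folklore] -/
theorem apExpC_union3_ring (hdK1 : Disjoint NK N₁) (hdK2 : Disjoint NK N₂) (hd12 : Disjoint N₁ N₂)
    (hK : ∀ e ∈ (↑NK : Set (Sym2 V)), ∀ z ∈ e, z ∈ VK)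
    (h₁ : ∀ e ∈ (↑N₁ : Set (Sym2 V)), ∀ z ∈ e, z ∈ V₁) (h₂ : ∀ e ∈ (↑N₂ : Set (Sym2 V)), ∀ z ∈ e, z ∈ V₂)
    (hK1 : VK ∩ V₁ ⊆ ({u} : Set V)) (h12 : V₁ ∩ V₂ ⊆ ({w} : Set V)) (hK2 : VK ∩ V₂ ⊆ ({v} : Set V))
    (hu2 : u ∉ V₂) (hv1 : v ∉ V₁) (huv : u ≠ v) (huw : u ≠ w) (hvw : v ≠ w)
    (hEK : EK ⊆ NK) (hCK : CK ⊆ NK) (hE₁ : E₁ ⊆ N₁) (hC₁ : C₁ ⊆ N₁) (hE₂ : E₂ ⊆ N₂) (hC₂ : C₂ ⊆ N₂)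
    (b s t : V) {γK γ₁ γ₂ : Finset (Sym2 V)} (gK : γK ⊆ EK) (g₁ : γ₁ ⊆ E₁) (g₂ : γ₂ ⊆ E₂) :
    apExpC (EK ∪ E₁ ∪ E₂) (CK ∪ C₁ ∪ C₂) (γK ∪ γ₁ ∪ γ₂) + 4 * Fintype.card V =
      apExpC EK CK γK + apExpC E₁ C₁ γ₁ + apExpC E₂ C₂ γ₂ +
          corrRing (pat3 (γK ∪ CK) v u b) (pat3 (γ₁ ∪ C₁) u w s) (pat3 (γ₂ ∪ C₂) w v t) +
        corrRing (pat3 (EK \ γK ∪ CK) v u b) (pat3 (E₁ \ γ₁ ∪ C₁) u w s) (pat3 (E₂ \ γ₂ ∪ C₂) w v t) := by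
  have hd : Disjoint NK (N₁ ∪ N₂) := Finset.disjoint_union_right.2 ⟨hdK1, hdK2⟩
  have hdE12 : Disjoint E₁ E₂ := Finset.disjoint_of_subset_left hE₁ (Finset.disjoint_of_subset_right hE₂ hd12)
  have hB : ∀ e ∈ (↑(N₁ ∪ N₂) : Set (Sym2 V)), ∀ z ∈ e, z ∈ V₁ ∪ V₂ := edges_union_verts h₁ h₂
  have hSB : VK ∩ (V₁ ∪ V₂) ⊆ ({u, v} : Set V) := ring_inter_subset_pair hK1 hK2
  have e1 := apExpC_series hd12 h₁ h₂ h12 hE₁ hE₂ hC₁ hC₂ g₁ g₂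
  have e2 := apExpC_parallel hd hK hB hSB huv hEK (Finset.union_subset_union hE₁ hE₂) hCK (Finset.union_subset_union hC₁ hC₂)
    gK (Finset.union_subset_union g₁ g₂)
  have sγ₁ : γ₁ ∪ C₁ ⊆ N₁ := Finset.union_subset (g₁.trans hE₁) hC₁
  have sγ₂ : γ₂ ∪ C₂ ⊆ N₂ := Finset.union_subset (g₂.trans hE₂) hC₂
  have sγ₁' : E₁ \ γ₁ ∪ C₁ ⊆ N₁ := Finset.union_subset (Finset.sdiff_subset.trans hE₁) hC₁
  have sγ₂' : E₂ \ γ₂ ∪ C₂ ⊆ N₂ := Finset.union_subset (Finset.sdiff_subset.trans hE₂) hC₂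
  have sK : (openGraph (↑(γK ∪ CK) : BondConfig V)).Reachable u v ↔ (openGraph (↑(γK ∪ CK) : BondConfig V)).Reachable v u :=
    ⟨Reachable.symm, Reachable.symm⟩
  have sK' : (openGraph (↑(EK \ γK ∪ CK) : BondConfig V)).Reachable u v ↔
      (openGraph (↑(EK \ γK ∪ CK) : BondConfig V)).Reachable v u := ⟨Reachable.symm, Reachable.symm⟩
  rw [Finset.union_union_union_comm γ₁ γ₂ C₁ C₂, sdiff_union_union_distrib hdE12 g₁ g₂ C₁ C₂,
    ite_prop_eq_ite_bool
      (p := (openGraph (↑(γK ∪ CK) : BondConfig V)).Reachable u v ∧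
        (openGraph (↑(γ₁ ∪ C₁ ∪ (γ₂ ∪ C₂)) : BondConfig V)).Reachable u v)
      (bb := (pat3 (γK ∪ CK) v u b).xy && (pat3 (γ₁ ∪ C₁) u w s).xy && (pat3 (γ₂ ∪ C₂) w v t).xy)
      (by rw [Bool.and_eq_true, Bool.and_eq_true, pat3_xy_iff, pat3_xy_iff, pat3_xy_iff,
        reachable_union_series h₁ h₂ h12 hu2 hv1 huw hvw huv sγ₁ sγ₂, sK, and_assoc]),
    ite_prop_eq_ite_bool
      (p := (openGraph (↑(EK \ γK ∪ CK) : BondConfig V)).Reachable u v ∧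
        (openGraph (↑(E₁ \ γ₁ ∪ C₁ ∪ (E₂ \ γ₂ ∪ C₂)) : BondConfig V)).Reachable u v)
      (bb := (pat3 (EK \ γK ∪ CK) v u b).xy && (pat3 (E₁ \ γ₁ ∪ C₁) u w s).xy && (pat3 (E₂ \ γ₂ ∪ C₂) w v t).xy)
      (by rw [Bool.and_eq_true, Bool.and_eq_true, pat3_xy_iff, pat3_xy_iff, pat3_xy_iff,
        reachable_union_series h₁ h₂ h12 hu2 hv1 huw hvw huv sγ₁' sγ₂', sK', and_assoc])] at e2
  have eU : apExpC (EK ∪ E₁ ∪ E₂) (CK ∪ C₁ ∪ C₂) (γK ∪ γ₁ ∪ γ₂) =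
      apExpC (EK ∪ (E₁ ∪ E₂)) (CK ∪ (C₁ ∪ C₂)) (γK ∪ (γ₁ ∪ γ₂)) := by
    rw [Finset.union_assoc, Finset.union_assoc, Finset.union_assoc]
  unfold corrRing
  rw [eU]
  omega

/-- **Trilinear decomposition of `tvalC` over a RING gluing of minors.** [folklore] -/
theorem tvalC_union3_ring (hdK1 : Disjoint NK N₁) (hdK2 : Disjoint NK N₂) (hd12 : Disjoint N₁ N₂)
    (hK : ∀ e ∈ (↑NK : Set (Sym2 V)), ∀ z ∈ e, z ∈ VK)
    (h₁ : ∀ e ∈ (↑N₁ : Set (Sym2 V)), ∀ z ∈ e, z ∈ V₁) (h₂ : ∀ e ∈ (↑N₂ : Set (Sym2 V)), ∀ z ∈ e, z ∈ V₂)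
    (hK1 : VK ∩ V₁ ⊆ ({u} : Set V)) (h12 : V₁ ∩ V₂ ⊆ ({w} : Set V)) (hK2 : VK ∩ V₂ ⊆ ({v} : Set V))
    (hu2 : u ∉ V₂) (hv1 : v ∉ V₁) (huv : u ≠ v) (huw : u ≠ w) (hvw : v ≠ w)
    (hEK : EK ⊆ NK) (hCK : CK ⊆ NK) (hE₁ : E₁ ⊆ N₁) (hC₁ : C₁ ⊆ N₁) (hE₂ : E₂ ⊆ N₂) (hC₂ : C₂ ⊆ N₂)
    {b s t : V} (hb1 : b ∉ V₁) (hb2 : b ∉ V₂) (hsK : s ∉ VK) (hs2 : s ∉ V₂) (htK : t ∉ VK) (ht1 : t ∉ V₁)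
    (hbu : b ≠ u) (hbv : b ≠ v) (hsu : s ≠ u) (hsv : s ≠ v) (hsw : s ≠ w) (htu : t ≠ u) (htv : t ≠ v) (htw : t ≠ w)
    (hbs : b ≠ s) (hbt : b ≠ t) (hst : s ≠ t) (wt : ℕ → ℝ) (tab : Pat3 → Pat3 → ℤ) :
    tvalC (fun n => wt (n + 4 * Fintype.card V)) (EK ∪ E₁ ∪ E₂) (CK ∪ C₁ ∪ C₂) b s t tab =
      ∑ γK ∈ EK.powerset, ∑ γ₁ ∈ E₁.powerset, ∑ γ₂ ∈ E₂.powerset,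
        wt (apExpC EK CK γK + apExpC E₁ C₁ γ₁ + apExpC E₂ C₂ γ₂ +
              corrRing (pat3 (γK ∪ CK) v u b) (pat3 (γ₁ ∪ C₁) u w s) (pat3 (γ₂ ∪ C₂) w v t) +
            corrRing (pat3 (EK \ γK ∪ CK) v u b) (pat3 (E₁ \ γ₁ ∪ C₁) u w s) (pat3 (E₂ \ γ₂ ∪ C₂) w v t)) *
          (tab (joinRing (pat3 (γK ∪ CK) v u b) (pat3 (γ₁ ∪ C₁) u w s) (pat3 (γ₂ ∪ C₂) w v t))
            (joinRing (pat3 (EK \ γK ∪ CK) v u b) (pat3 (E₁ \ γ₁ ∪ C₁) u w s) (pat3 (E₂ \ γ₂ ∪ C₂) w v t)) : ℝ) := by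
  have hdE1 : Disjoint EK E₁ := Finset.disjoint_of_subset_left hEK (Finset.disjoint_of_subset_right hE₁ hdK1)
  have hdE2 : Disjoint EK E₂ := Finset.disjoint_of_subset_left hEK (Finset.disjoint_of_subset_right hE₂ hdK2)
  have hdE12 : Disjoint E₁ E₂ := Finset.disjoint_of_subset_left hE₁ (Finset.disjoint_of_subset_right hE₂ hd12)
  have hd : Disjoint (EK ∪ E₁) E₂ := Finset.disjoint_union_left.2 ⟨hdE2, hdE12⟩
  unfold tvalC
  beta_reduce
  rw [sum_powerset_union_disj hd]
  rw [sum_powerset_union_disj hdE1]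
  refine Finset.sum_congr rfl fun γK hγK => Finset.sum_congr rfl fun γ₁ hγ₁ => Finset.sum_congr rfl fun γ₂ hγ₂ => ?_
  have gK := Finset.mem_powerset.1 hγK
  have g₁ := Finset.mem_powerset.1 hγ₁
  have g₂ := Finset.mem_powerset.1 hγ₂
  have p1 := pat3_union3_ring hK h₁ h₂ hK1 h12 hK2 hu2 hv1 huv huw hvw hb1 hb2 hsK hs2 htK ht1 hbu hbv hsu hsv hsw htu htv htw
    hbs hbt hst (Finset.union_subset (gK.trans hEK) hCK) (Finset.union_subset (g₁.trans hE₁) hC₁)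
    (Finset.union_subset (g₂.trans hE₂) hC₂)
  have sK' : EK \ γK ∪ CK ⊆ NK := Finset.union_subset (Finset.sdiff_subset.trans hEK) hCK
  have s1' : E₁ \ γ₁ ∪ C₁ ⊆ N₁ := Finset.union_subset (Finset.sdiff_subset.trans hE₁) hC₁
  have s2' : E₂ \ γ₂ ∪ C₂ ⊆ N₂ := Finset.union_subset (Finset.sdiff_subset.trans hE₂) hC₂
  have p2 := pat3_union3_ring hK h₁ h₂ hK1 h12 hK2 hu2 hv1 huv huw hvw hb1 hb2 hsK hs2 htK ht1 hbu hbv hsu hsv hsw htu htv htw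
    hbs hbt hst sK' s1' s2'
  have eγ : γK ∪ γ₁ ∪ γ₂ ∪ (CK ∪ C₁ ∪ C₂) = γK ∪ CK ∪ (γ₁ ∪ C₁) ∪ (γ₂ ∪ C₂) := by
    ext e
    simp only [Finset.mem_union]
    tauto
  have eγ' : (EK ∪ E₁ ∪ E₂) \ (γK ∪ γ₁ ∪ γ₂) ∪ (CK ∪ C₁ ∪ C₂) = EK \ γK ∪ CK ∪ (E₁ \ γ₁ ∪ C₁) ∪ (E₂ \ γ₂ ∪ C₂) := by
    rw [sdiff_union_union_distrib hd (Finset.union_subset_union gK g₁) g₂, sdiff_union_union_distrib hdE1 gK g₁]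
  rw [eγ, eγ', apExpC_union3_ring hdK1 hdK2 hd12 hK h₁ h₂ hK1 h12 hK2 hu2 hv1 huv huw hvw hEK hCK hE₁ hC₁ hE₂ hC₂ b s t gK g₁ g₂,
    p1, p2]

/-- **RING on minors from data (symmetrised certificate).** [cite: AyyerLinussonRavichandran2025, §7 (p. 22)] -/
theorem ringC_level_nonneg_of_symCertG (hdK1 : Disjoint NK N₁) (hdK2 : Disjoint NK N₂) (hd12 : Disjoint N₁ N₂)
    (hK : ∀ e ∈ (↑NK : Set (Sym2 V)), ∀ z ∈ e, z ∈ VK)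
    (h₁ : ∀ e ∈ (↑N₁ : Set (Sym2 V)), ∀ z ∈ e, z ∈ V₁) (h₂ : ∀ e ∈ (↑N₂ : Set (Sym2 V)), ∀ z ∈ e, z ∈ V₂)
    (hK1 : VK ∩ V₁ ⊆ ({u} : Set V)) (h12 : V₁ ∩ V₂ ⊆ ({w} : Set V)) (hK2 : VK ∩ V₂ ⊆ ({v} : Set V))
    (hu2 : u ∉ V₂) (hv1 : v ∉ V₁) (huv : u ≠ v) (huw : u ≠ w) (hvw : v ≠ w)
    (hEK : EK ⊆ NK) (hCK : CK ⊆ NK) (hE₁ : E₁ ⊆ N₁) (hC₁ : C₁ ⊆ N₁) (hE₂ : E₂ ⊆ N₂) (hC₂ : C₂ ⊆ N₂)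
    {b s t : V} (hb1 : b ∉ V₁) (hb2 : b ∉ V₂) (hsK : s ∉ VK) (hs2 : s ∉ V₂) (htK : t ∉ VK) (ht1 : t ∉ V₁)
    (hbu : b ≠ u) (hbv : b ≠ v) (hsu : s ≠ u) (hsv : s ≠ v) (hsw : s ≠ w) (htu : t ≠ u) (htv : t ≠ v) (htw : t ≠ w)
    (hbs : b ≠ s) (hbt : b ≠ t) (hst : s ≠ t)
    (hKsp : IsTTSP NK v u) (h1sp : IsTTSP N₁ u w) (h2sp : IsTTSP N₂ w v)
    (hbK : ∃ e ∈ NK, b ∈ e) (hs1 : ∃ e ∈ N₁, s ∈ e) (ht2 : ∃ e ∈ N₂, t ∈ e)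
    (T : ℕ → Pat3 → Pat3 → ℤ) (D : ℕ) (prods : List Prod3G) (hok : (prods.all Prod3G.okC) = true)
    (hcert : ∀ d : ℕ, ∀ PK QK P1 Q1 P2 Q2 : Pat3,
      8 * ∑ j : Fin (prods.map Prod3G.toProd3).length,
          (((prods.map Prod3G.toProd3).get j).lam : ℤ) * ((prods.map Prod3G.toProd3).get j).tensor d PK QK P1 Q1 P2 Q2 ≤
        D * target3Sym joinRing corrRing T d PK QK P1 Q1 P2 Q2)
    (lam : ℕ) : 0 ≤ (D : ℤ) * lev2C (EK ∪ E₁ ∪ E₂) (CK ∪ C₁ ∪ C₂) b s t T lam :=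
  cone3C_level_nonneg_sym joinRing corrRing (4 * Fintype.card V)
    (fun wt tab => tvalC_union3_ring hdK1 hdK2 hd12 hK h₁ h₂ hK1 h12 hK2 hu2 hv1 huv huw hvw hEK hCK hE₁ hC₁ hE₂ hC₂ hb1 hb2 hsK
      hs2 htK ht1 hbu hbv hsu hsv hsw htu htv htw hbs hbt hst wt tab)
    T D Finset.univ (fun j => (prods.map Prod3G.toProd3).get j) hcert
    (Prod3G.valid3C hKsp h1sp h2sp hEK hCK hE₁ hC₁ hE₂ hC₂ hbK hs1 ht2 hbv hbu hsu hsw htw htv prods hok) lam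

end RingMinor

end FK

end Summit.CriticalPhenomena.PercolationContinuityZ3.Theorems

end
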